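import Literature.AlgebraicGeometry.Motives.SepQuotientPieces
import Literature.AlgebraicGeometry.Motives.BaseChangeProofs
import Literature.AlgebraicGeometry.Morphisms.GeometricPointsLiftSurjective
import HarnessLib

/-!
# Fibres of a finite-group quotient on GEOMETRIC points are orbits — over ANY algebraically closed field `Ω ⊇ k`
# ([SGA1] Exp. V Prop. 1.1, 1.9; [MumfordAV1970] §7 Thm. p. 66)

Topic `Literature/AlgebraicGeometry/Motives`.  THEOREMS ONLY (no definition, no named fact, no instance, no notation, no `sorry`).
Cell `hodgecm-mathlib` (D-0151), FLOOR 0, programme F0P5a (crux item stmt-HodgeConjecture-24832): the `Ω = \overline{F_w}` reading of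
«geometric fibres of the level maps `u : M⋆_N → M⋆_K` are `K/N`-orbits» that the D.8 ∕ C3 dictionary needs (MOD-PLAN v0.4 §13 (3), F0P5a-plan (g2)
Gamma3-ROWS Q3) — the tree had it for `Ω = ℂ` only.

The tree proves, for a quotient `p : X → Y` of a PROJECTIVE `k`-scheme by a finite group `Δ ≤ Aut_k(X)` for separated test objects
(★ `Motives.IsSepQuotient`, `Motives/SeparatedQuotient`), with `Y` separated:
* ★ `isoFiniteQuotient_of_isSepQuotient` — `Y ≅ X/Δ` under `X` (`Motives/FiniteQuotientBaseChange`);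
* ★ `finiteQuotient.exists_aut_apply_eq_of_mk_apply_eq` — the fibres of `X → X/Δ` on SCHEME points are `Δ`-orbits ([SGA1] V 1.1);
* ★ `isSepQuotient_baseChangeHom_of_isProjectiveOver` — quotients commute with base change ALONG `τ : L → ℂ`;
* ★ `IsSepQuotient.exists_map_act_eq_of_map_eq` — fibres of `p(ℂ)` on COMPLEX points of a `ℂ`-scheme are orbits (`Motives/SepQuotientPieces`).
The last two are typed with `ℂ`; their proofs use only that the point field is the (algebraically closed) BASE field (★ `AlgPoints.eq_of_pt_eq`)
and that the base change is along a field map (★ `isGeometricQuotient_baseChange (φ : k →+* K)` is field-general).  This file re-runs them for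
an arbitrary field map `τ : k → Ω` ∕ algebraically closed base, and assembles:

* `AlgPoints.baseChangeEquiv_comp_ringHom` — naturality of ★ `AlgPoints.baseChangeEquiv σ` in the `k`-scheme for ANY `σ : k →+* L`
  (general-`σ` twin of ★ `AlgPoints.baseChangeEquiv_comp`, [GortzWedhorn2020] Prop. 4.16).
* `isSepQuotient_baseChangeHom_of_isProjectiveOver_ringHom` — **finite-group quotients of projective schemes commute with base change along ANY
  field map `τ : L → Ω`** ([SGA1] V Prop. 1.9 for the flat base change `Spec Ω → Spec L`).
* `IsSepQuotient.exists_map_act_eq_of_map_eq_of_isAlgClosed` — for `K` ALGEBRAICALLY CLOSED and `X` projective over `K`: two `K`-rational points with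
  the same image under `p` differ by some `act g` ([SGA1] V 1.1).
* **`IsSepQuotient.exists_map_act_eq_of_map_eq_geometric`** — for `X` projective over ANY field `k`, `τ : k → Ω` with `Ω` algebraically closed, and
  `Ω`-points `P, P′` of `X` over `k` with `p(P) = p(P′)`: `∃ g, (act g)(P) = P′`.  (E.g. `k = F` a number field, `Ω = \overline{F_w}`, `p` a level map
  of the record unitary Shimura curve, an `IsSepQuotient` by ★ `levelQuotientUP_GS`.)
* `IsSepQuotient.surjective_map_geometric` — and `p` is onto on `Ω`-points.

HC_CM is proved only modulo the 7 printed citations until rung 0 closes; this file is a generic leaf and changes no count.  Ours (formalisation glue);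
axioms `propext`, `Classical.choice`, `Quot.sound`.

## References
* [SGA1] A. Grothendieck, SGA 1, Exp. V, Prop. 1.1 (fibres of `X → X/G` are orbits), Prop. 1.9 (quotients commute with flat base change).
* [MumfordAV1970] D. Mumford, *Abelian Varieties*, §7 Thm. p. 66 and the Remark following it.
* [GortzWedhorn2020] U. Görtz, T. Wedhorn, *Algebraic Geometry I* (2nd ed.), Prop. 4.16 (base change and points), Prop. 14.57 (projectivity and base change).
-/

set_option autoImplicit false

noncomputable section

open CategoryTheory CategoryTheory.Limits AlgebraicGeometry
open Literature.AlgebraicGeometry.RelativeSpec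

namespace Literature.AlgebraicGeometry.Motives

/-! ### §0 Naturality of `X(L) ≃ X_σ(L)` in `X`, for any `σ : k →+* L` -/

section Naturality

variable {k L : Type} [Field k] [Field L] (σ : k →+* L)

/-- `X(L) ⥲ X_σ(L)` (★ `AlgPoints.baseChangeEquiv`) is natural in the `k`-scheme `X`: it carries `P ≫ g` to `P_σ ≫ g_σ`, for ANY field map
`σ : k → L` (universal property of the fibre product). General-`σ` twin of ★ `AlgPoints.baseChangeEquiv_comp` (`σ = k → ℂ`).
[cite: GortzWedhorn2020, Prop. 4.16] -/
theorem AlgPoints.baseChangeEquiv_comp_ringHom {Z W : SchemeOver k} (g : Z ⟶ W) (P : letI := σ.toAlgebra; AlgPoints Z L) :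
    letI := σ.toAlgebra
    AlgPoints.baseChangeEquiv σ W (P ≫ g) = AlgPoints.baseChangeEquiv σ Z P ≫ (baseChangeHom σ).map g := by
  letI := σ.toAlgebra
  rw [Equiv.apply_eq_iff_eq_symm_apply]
  apply Over.OverMorphism.ext
  rw [AlgPoints.baseChangeEquiv_symm_apply_left, Over.comp_left, Over.comp_left, Category.assoc]
  erw [baseChangeHom_map_left_comp_fst]
  rw [← Category.assoc, AlgPoints.baseChangeEquiv_apply_left_comp_fst]
  rfl

end Naturality

/-! ### §1 Finite-group quotients commute with base change along any field map -/

section BaseChange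

set_option maxHeartbeats 400000 in
/-- **Finite-group quotients of projective schemes commute with base change along ANY field map** ([SGA1] V Prop. 1.9 for the flat base change
`Spec Ω → Spec L`; [MumfordAV1970] §7 Thm. p. 66): `L`, `Ω` fields, `τ : L →+* Ω`, `Δ` a finite group acting on the PROJECTIVE `L`-scheme `Y` by
`L`-automorphisms, `p : Y ⟶ Z` a quotient by `Δ` for separated test objects with `Z` separated over `L`; then `Z ⊗_{L,τ} Ω` is separated over `Ω` and
`p ⊗_{L,τ} Ω` is a quotient of `Y ⊗_{L,τ} Ω` by the base-changed action.  The proof of ★ `isSepQuotient_baseChangeHom_of_isProjectiveOver` (`Ω = ℂ`)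
VERBATIM with `ℂ ↦ Ω`: `Z ≅ Y/Δ`, the quotient map is an affine geometric quotient, geometric quotients commute with base change along a field map
(★ `ActionOver.isGeometricQuotient_baseChange`), and a geometric quotient is a separated quotient. [cite: SGA1, Exp. V Prop. 1.9] [cite: MumfordAV1970, §7 Thm. p. 66] -/
theorem isSepQuotient_baseChangeHom_of_isProjectiveOver_ringHom (L Ω : Type) [Field L] [Field Ω] (τ : L →+* Ω) (Δ : Type)
    [Group Δ] [Fintype Δ] (Y Z : SchemeOver L) (hY : IsProjectiveOver Y) (act : Δ →* Aut Y) (p : Y ⟶ Z)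
    (hZ : IsSeparated Z.hom) (hq : IsSepQuotient (fun g => act g) p) :
    IsSeparated ((Motives.baseChangeHom τ).obj Z).hom ∧
      IsSepQuotient (fun g => (Motives.baseChangeHom τ).mapIso (act g)) ((Motives.baseChangeHom τ).map p) := by
  refine ⟨?_, ?_⟩
  · -- separatedness is stable under base change
    haveI := hZ
    change IsSeparated (pullback.snd Z.hom (Spec.map (CommRingCat.ofHom τ)))
    infer_instance
  -- (1) `Z ≅ Y/Δ`
  haveI : IsSeparated Y.hom := by haveI := hY.isProper; infer_instance
  let ρ : ActionOver Y.hom Δ := ⟨((Over.forget _).mapAut Y).comp act, fun g => Over.w (act g).hom⟩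
  have hcov := ActionOver.forall_exists_stableAffineOpen_of_isProjectiveOver ρ hY
  obtain ⟨i, hi⟩ := isoFiniteQuotient_of_isSepQuotient hY act p hZ hq
  refine IsSepQuotient.of_comp_iso ((Motives.baseChangeHom τ).mapIso i) ?_
  rw [Functor.mapIso_hom, ← Functor.map_comp, hi]
  -- (2) the quotient map `π : Y → Y/Δ` is an affine geometric quotient, and so is its base change
  have hgq : ρ.IsGeometricQuotient (finiteQuotient.mk ρ hcov).left := ρ.isGeometricQuotient_gluedMk hcov
  haveI : IsAffineHom (finiteQuotient.mk ρ hcov).left := finiteQuotient.isAffineHom_mk_left ρ hcov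
  let act' : Δ →* Aut ((Motives.baseChangeHom τ).obj Y) := ((Motives.baseChangeHom τ).mapAut Y).comp act
  let ρ' : ActionOver ((Motives.baseChangeHom τ).obj Y).hom Δ :=
    ⟨((Over.forget _).mapAut _).comp act', fun g => Over.w (act' g).hom⟩
  have hρ' : ∀ g : Δ, (ρ'.aut g).hom ≫ pullback.fst Y.hom (Spec.map (CommRingCat.ofHom τ)) =
      pullback.fst Y.hom (Spec.map (CommRingCat.ofHom τ)) ≫ (ρ.aut g).hom := fun g =>
    baseChangeHom_map_left_comp_fst τ (act g).hom
  have hgq' : ρ'.IsGeometricQuotient ((Motives.baseChangeHom τ).map (finiteQuotient.mk ρ hcov)).left :=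
    ρ.isGeometricQuotient_baseChange τ (Over.w (finiteQuotient.mk ρ hcov)) hgq ρ' hρ' _
      (baseChangeHom_map_left_comp_fst τ (finiteQuotient.mk ρ hcov))
      (Over.w ((Motives.baseChangeHom τ).map (finiteQuotient.mk ρ hcov)))
  -- (3) a geometric quotient is a separated quotient
  exact isSepQuotient_of_isGeometricQuotient _ _ ρ' id id (fun g => rfl) (fun g => rfl) hgq'

end BaseChange

/-! ### §2 Rational points over an algebraically closed base field -/

section AlgClosedBase

variable {K : Type} [Field K] [IsAlgClosed K] {Δ : Type} [Group Δ] [Finite Δ] {X Y : SchemeOver K}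
  (act : Δ →* Aut X) (p : X ⟶ Y)

/-- **Over an algebraically closed field `K`, the fibres of `p(K)` on `K`-RATIONAL points are single `Δ`-orbits** (`X` projective over `K`, `Y` separated,
`p` a quotient of `X` by `Δ` for separated test objects): `Y ≅ X/Δ`; two `K`-points with the same image in `(X/Δ)(K)` have the same image scheme
point, hence underlying points in one orbit (★ `finiteQuotient.exists_aut_apply_eq_of_mk_apply_eq`), and a `K`-point of a `K`-scheme locally of
finite type is determined by its underlying point (★ `AlgPoints.eq_of_pt_eq`).  The ★ `ℂ`-version VERBATIM with `ℂ ↦ K`.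
[cite: SGA1, Exp. V, Prop. 1.1] [cite: MumfordAV1970, §7 Thm. p. 66 (1)] -/
theorem IsSepQuotient.exists_map_act_eq_of_map_eq_of_isAlgClosed (hX : IsProjectiveOver X) (hY : IsSeparated Y.hom)
    (hp : IsSepQuotient (fun g => act g) p) {P P' : AlgPoints X K} (h : AlgPoints.map p P = AlgPoints.map p P') :
    ∃ g : Δ, AlgPoints.map (act g).hom P = P' := by
  haveI : IsProper X.hom := hX.isProper
  haveI : IsSeparated X.hom := inferInstance
  haveI : LocallyOfFiniteType X.hom := inferInstance
  let ρ : ActionOver X.hom Δ := ⟨((Over.forget _).mapAut X).comp act, fun g => Over.w (act g).hom⟩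
  have hcov := ActionOver.forall_exists_stableAffineOpen_of_isProjectiveOver ρ hX
  obtain ⟨i, hi⟩ := isoFiniteQuotient_of_isSepQuotient hX act p hY hp
  -- same image in `(X/Δ)(K)`, hence same image scheme point
  have h1 : AlgPoints.map (finiteQuotient.mk ρ hcov) P = AlgPoints.map (finiteQuotient.mk ρ hcov) P' := by
    rw [← hi, AlgPoints.map_comp_apply, AlgPoints.map_comp_apply, h]
  have hpt : (finiteQuotient.mk ρ hcov).left P.pt = (finiteQuotient.mk ρ hcov).left P'.pt := by
    rw [← AlgPoints.pt_map, ← AlgPoints.pt_map, h1]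
  -- underlying points in one orbit
  obtain ⟨g, hg⟩ := finiteQuotient.exists_aut_apply_eq_of_mk_apply_eq ρ hcov hpt
  refine ⟨g, AlgPoints.eq_of_pt_eq ?_⟩
  rw [AlgPoints.pt_map]
  exact hg

end AlgClosedBase

/-! ### §3 Geometric points: `X` over any field `k`, `Ω ⊇ k` algebraically closed -/

section Geometric

variable {k Ω : Type} [Field k] [Field Ω] [IsAlgClosed Ω] (τ : k →+* Ω) {Δ : Type} [Group Δ] [Fintype Δ]
  {X Y : SchemeOver k} (act : Δ →* Aut X) (p : X ⟶ Y)

/-- **The fibres of `p` on GEOMETRIC points are single `Δ`-orbits**: `X` projective over ANY field `k`, `Y` separated, `p : X → Y` a quotient of `X` by the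
finite group `Δ ≤ Aut_k(X)` for separated test objects, `τ : k → Ω` with `Ω` algebraically closed; then two `Ω`-points `P, P′` of `X` over `k` with
`p(P) = p(P′)` satisfy `(act g)(P) = P′` for some `g`.  Proof: pass to `Ω`-rational points of `X ⊗_τ Ω` (★ `AlgPoints.baseChangeEquiv`, natural in `X`
by §0), where the base-changed `p` is again a separated quotient of a projective scheme (§1, ★ `IsProjectiveOver.baseChange_obj`), and apply §2.
[cite: SGA1, Exp. V, Prop. 1.1 and Prop. 1.9] [cite: MumfordAV1970, §7 Thm. p. 66] [cite: GortzWedhorn2020, Prop. 4.16 and Prop. 14.57] -/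
theorem IsSepQuotient.exists_map_act_eq_of_map_eq_geometric (hX : IsProjectiveOver X) (hY : IsSeparated Y.hom)
    (hp : IsSepQuotient (fun g => act g) p) {P P' : letI := τ.toAlgebra; AlgPoints X Ω}
    (h : letI := τ.toAlgebra; AlgPoints.map p P = AlgPoints.map p P') :
    letI := τ.toAlgebra; ∃ g : Δ, AlgPoints.map (act g).hom P = P' := by
  letI := τ.toAlgebra
  -- the base-changed quotient
  obtain ⟨hY', hp'⟩ := isSepQuotient_baseChangeHom_of_isProjectiveOver_ringHom k Ω τ Δ X Y hX act p hY hp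
  have hX' : IsProjectiveOver ((baseChangeHom τ).obj X) := by
    have e : baseChangeHom τ = baseChange k Ω := by
      have : τ = algebraMap k Ω := rfl
      rw [this]; rfl
    rw [e]
    exact hX.baseChange_obj Ω
  -- the `Ω`-rational points of `X_Ω` attached to `P`, `P'` have the same image
  set e := AlgPoints.baseChangeEquiv τ X with he
  have h' : AlgPoints.map ((baseChangeHom τ).map p) (e P) = AlgPoints.map ((baseChangeHom τ).map p) (e P') := by
    rw [AlgPoints.map_apply, AlgPoints.map_apply, he, ← AlgPoints.baseChangeEquiv_comp_ringHom, ← AlgPoints.baseChangeEquiv_comp_ringHom,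
      ← AlgPoints.map_apply, ← AlgPoints.map_apply, h]
  obtain ⟨g, hg⟩ := IsSepQuotient.exists_map_act_eq_of_map_eq_of_isAlgClosed
    (((baseChangeHom τ).mapAut X).comp act) ((baseChangeHom τ).map p) hX' hY' hp' h'
  refine ⟨g, ?_⟩
  -- transport back along `e`
  apply e.injective
  rw [AlgPoints.map_apply, he, AlgPoints.baseChangeEquiv_comp_ringHom, ← he]
  rw [AlgPoints.map_apply] at hg
  exact hg

/-- **`p` is onto on geometric points** (same hypotheses): every `Ω`-point of `Y` over `k` lifts along `p` — base change to `Ω` and the surjectivity of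
`X_Ω(Ω) → (X_Ω/Δ)(Ω)` (★ `finiteQuotient.mk_left_surjective` read on `Ω`-rational points through ★ `exists_point_through_closedPoint`-free means:
★ `Morphisms.exists_over_comp_eq_of_surjective`, the quotient map being surjective and locally of finite type).
[cite: SGA1, Exp. V, Prop. 1.1] [cite: GortzWedhorn2020, Cor. 3.36 (p. 83)] -/
theorem IsSepQuotient.surjective_map_geometric (hX : IsProjectiveOver X) (hY : IsSeparated Y.hom)
    (hp : IsSepQuotient (fun g => act g) p) :
    letI := τ.toAlgebra; Function.Surjective (AlgPoints.map (L := Ω) p) := by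
  letI := τ.toAlgebra
  haveI : IsProper X.hom := hX.isProper
  haveI : IsSeparated X.hom := inferInstance
  let ρ : ActionOver X.hom Δ := ⟨((Over.forget _).mapAut X).comp act, fun g => Over.w (act g).hom⟩
  have hcov := ActionOver.forall_exists_stableAffineOpen_of_isProjectiveOver ρ hX
  obtain ⟨i, hi⟩ := isoFiniteQuotient_of_isSepQuotient hX act p hY hp
  -- `p = π ≫ i⁻¹` with `π` surjective and locally of finite type
  haveI : Surjective (finiteQuotient.mk ρ hcov).left := ⟨finiteQuotient.mk_left_surjective ρ hcov⟩
  haveI : LocallyOfFiniteType X.hom := inferInstance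
  haveI : LocallyOfFiniteType ((finiteQuotient.mk ρ hcov).left ≫ (finiteQuotient ρ).hom) := by
    rw [Over.w (finiteQuotient.mk ρ hcov)]; infer_instance
  haveI : LocallyOfFiniteType (finiteQuotient.mk ρ hcov).left := locallyOfFiniteType_of_comp _ (finiteQuotient ρ).hom
  intro Q
  have hpi : p = finiteQuotient.mk ρ hcov ≫ i.inv := by rw [← hi, Category.assoc, Iso.hom_inv_id, Category.comp_id]
  obtain ⟨P, hP⟩ := Literature.AlgebraicGeometry.Morphisms.exists_over_comp_eq_of_surjective (finiteQuotient.mk ρ hcov)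
    (Spec.map (CommRingCat.ofHom (algebraMap k Ω))) (Q ≫ i.hom)
  refine ⟨P, ?_⟩
  rw [AlgPoints.map_apply, hpi, ← Category.assoc, hP, Category.assoc, Iso.hom_inv_id, Category.comp_id]

end Geometric

end Literature.AlgebraicGeometry.Motives

end
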